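import Mathlib
import Summits.ValiantsHypothesis.ValiantsHypothesis.Theorems.ElementaryWordLengthVpWordQpWords

/-!
# Crux `WordLengthQP` (stmt-ValiantsHypothesis-6623), line `Sketch`, stub `stub_prodWord`

Width-2 products are cheap words (the "cheap words" step of the converse transfer
`WordLengthQP → EpsOrderLadder`): every entry of a product of at most `2^e` width-2 matrices over
`ℂ[x̄]` whose entries are S-affine (`C b` or `C a * X v + C b`, `a b ∈ ℂ`) is the argument `g`
of an affine elementary word for `E_{pr}(g)` of length `≤ 2 · 8^e`, at every off-diagonal
position `(p, r)` of `E₃(ℂ[x̄])` simultaneously.  Divide and conquer,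
`(A B)ₛₜ = Aₛ₀ B₀ₜ + Aₛ₁ B₁ₜ` with `A`, `B` products of `≤ 2^e` factors each, through the
Ben-Or–Cleve word algebra of
`Summit.ValiantsHypothesis.ValiantsHypothesis.Theorems.VpWordQp` (sums concatenate, products are
Steinberg commutators of length `2m₁ + 2m₂`): `2 · (4 · (2 · 8^e) + 4 · (2 · 8^e)) = 2 · 8^(e+1)`,
so `8^e = (2^e)^3` is exactly the Ben-Or–Cleve cube [BenOrCleve1992, Thm. 1].
-/

-- `Summit.ValiantsHypothesis.ValiantsHypothesis.…` is the tree's mandated single-conjunct layout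
-- (Sub = Summit), so the duplicated namespace component is intended.
set_option linter.dupNamespace false

open MvPolynomial
open Summit.ValiantsHypothesis.ValiantsHypothesis.Theorems.VpWordQp

namespace Summit.ValiantsHypothesis.ValiantsHypothesis.Cruxes.WordLengthQP.EpsOrderLadder

/-- `HasWordAt[i, j, g, m]` (local notation, not a definition; the same notation as in
`ElementaryWordLengthVpWordQpWords.lean`): the transvection `E_{ij}(g)` is the matrix of a word of
at most `m` off-diagonal affine elementary letters `E_{ab}(c)` / `E_{ab}(c · x_v)`, a letter
`l : Fin 3 × Fin 3 × k × Option σ` being read as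
`Matrix.transvection l.1 l.2.1 (C l.2.2.1 * l.2.2.2.elim 1 X)`. -/
local notation3 (prettyPrint := false) "HasWordAt[" i ", " j ", " g ", " m "]" =>
  ∃ w : List (Fin 3 × Fin 3 × _ × Option _), List.length w ≤ m ∧ (∀ l ∈ w, l.1 ≠ l.2.1) ∧
    List.prod (List.map (fun l => Matrix.transvection l.1 l.2.1
      (MvPolynomial.C l.2.2.1 * l.2.2.2.elim 1 MvPolynomial.X)) w) = Matrix.transvection i j g

/-- An S-affine entry `C b` or `C a * X v + C b` is a word of length `≤ 2` at every off-diagonal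
position (one or two letters). [folklore] -/
theorem prodWord_affine {σ : Type} {g : MvPolynomial σ ℂ}
    (hg : (∃ b : ℂ, g = C b) ∨ (∃ (a b : ℂ) (v : σ), g = C a * X v + C b))
    {p r : Fin 3} (hpr : p ≠ r) : HasWordAt[p, r, g, 2] := by
  rcases hg with ⟨b, rfl⟩ | ⟨a, b, v, rfl⟩
  · exact hasWordAt_mono (hasWordAt_C hpr b) (by norm_num)
  · exact hasWordAt_add hpr (hasWordAt_C_mul_X hpr a v) (hasWordAt_C hpr b)

/-- The entries `1`, `0` of the identity matrix are words of length `≤ 1` at every off-diagonal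
position. [folklore] -/
theorem prodWord_one {σ : Type} (s t : Fin 2) {p r : Fin 3} (hpr : p ≠ r) :
    HasWordAt[p, r, (1 : Matrix (Fin 2) (Fin 2) (MvPolynomial σ ℂ)) s t, 1] := by
  rw [Matrix.one_apply]
  split_ifs
  · exact hasWordAt_one hpr
  · have h := hasWordAt_C (σ := σ) hpr (0 : ℂ)
    rwa [C_0] at h

/-- The multiplication step `(A B)ₛₜ = Aₛ₀ B₀ₜ + Aₛ₁ B₁ₜ`: if all entries of `A` and of `B` are
words of length `≤ m` at every off-diagonal position, then all entries of `A * B` are words of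
length `≤ 8 m` (two Steinberg commutators of length `4 m`, concatenated). [folklore] -/
theorem prodWord_mul {σ : Type} {A B : Matrix (Fin 2) (Fin 2) (MvPolynomial σ ℂ)} {m : ℕ}
    (hA : ∀ s t : Fin 2, ∀ p r : Fin 3, p ≠ r → HasWordAt[p, r, A s t, m])
    (hB : ∀ s t : Fin 2, ∀ p r : Fin 3, p ≠ r → HasWordAt[p, r, B s t, m]) :
    ∀ s t : Fin 2, ∀ p r : Fin 3, p ≠ r → HasWordAt[p, r, (A * B) s t, 8 * m] := by
  intro s t p r hpr
  rw [Matrix.mul_apply, Fin.sum_univ_two]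
  have h0 := hasWordAt_mul_all (hA s 0) (hB 0 t) p r hpr
  have h1 := hasWordAt_mul_all (hA s 1) (hB 1 t) p r hpr
  exact hasWordAt_mono (hasWordAt_add hpr h0 h1) (by omega)

/-- The divide-and-conquer induction: all entries of a product of `≤ 2^e` S-affine width-2
matrices over `ℂ[x̄]` are words of length `≤ 2 · 8^e` at every off-diagonal position (split the
list into two halves of `≤ 2^e` factors each and apply `prodWord_mul`). [folklore] -/
theorem prodWord_all {σ : Type} (e : ℕ) :
    ∀ ms : List (Matrix (Fin 2) (Fin 2) (MvPolynomial σ ℂ)), ms.length ≤ 2 ^ e →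
    (∀ m ∈ ms, ∀ i j : Fin 2, (∃ b : ℂ, m i j = C b) ∨
      (∃ (a b : ℂ) (v : σ), m i j = C a * X v + C b)) →
    ∀ s t : Fin 2, ∀ p r : Fin 3, p ≠ r → HasWordAt[p, r, ms.prod s t, 2 * 8 ^ e] := by
  induction e with
  | zero =>
    intro ms hlen hS s t p r hpr
    rcases ms with _ | ⟨m, _ | ⟨_, _⟩⟩
    · rw [List.prod_nil]
      exact hasWordAt_mono (prodWord_one s t hpr) (by norm_num)
    · rw [List.prod_singleton]
      exact hasWordAt_mono (prodWord_affine (hS m (by simp) s t) hpr) (by norm_num)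
    · exact absurd hlen (by simp)
  | succ e ih =>
    intro ms hlen hS s t p r hpr
    rw [← List.take_append_drop (2 ^ e) ms, List.prod_append]
    have htake : (ms.take (2 ^ e)).length ≤ 2 ^ e := by
      rw [List.length_take]
      exact min_le_left _ _
    have hdrop : (ms.drop (2 ^ e)).length ≤ 2 ^ e := by
      rw [List.length_drop]
      rw [pow_succ] at hlen
      omega
    have hA := ih _ htake fun m hm => hS m (List.mem_of_mem_take hm)
    have hB := ih _ hdrop fun m hm => hS m (List.mem_of_mem_drop hm)
    refine hasWordAt_mono (prodWord_mul hA hB s t p r hpr) ?_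
    rw [pow_succ]
    omega

/-- **stub_prodWord** (width-2 products are cheap words): every entry of a product of at most
`2^e` width-2 matrices over `ℂ[x̄]` with S-affine entries (`C b` or `C a * X v + C b`) is the
argument of an affine elementary word of length `≤ 2 · 8^e` at every off-diagonal position of
`E₃` — divide and conquer `(AB)ₛₜ = Aₛ₀B₀ₜ + Aₛ₁B₁ₜ` through the Ben-Or–Cleve word algebra
(sums concatenate, products are Steinberg commutators of length `2m₁ + 2m₂`). [folklore] -/
theorem stub_prodWord {σ : Type} (e : ℕ) (ms : List (Matrix (Fin 2) (Fin 2) (MvPolynomial σ ℂ)))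
    (hlen : ms.length ≤ 2 ^ e)
    (hS : ∀ m ∈ ms, ∀ i j : Fin 2, (∃ b : ℂ, m i j = MvPolynomial.C b) ∨
      (∃ (a b : ℂ) (v : σ), m i j = MvPolynomial.C a * MvPolynomial.X v + MvPolynomial.C b))
    (s t : Fin 2) (p r : Fin 3) (hpr : p ≠ r) :
    ∃ w : List (Fin 3 × Fin 3 × ℂ × Option σ), w.length ≤ 2 * 8 ^ e ∧
      (∀ l ∈ w, l.1 ≠ l.2.1) ∧
      (w.map (fun l => Matrix.transvection l.1 l.2.1
        (MvPolynomial.C l.2.2.1 * l.2.2.2.elim 1 MvPolynomial.X))).prod =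
        Matrix.transvection p r (ms.prod s t) :=
  prodWord_all e ms hlen hS s t p r hpr

end Summit.ValiantsHypothesis.ValiantsHypothesis.Cruxes.WordLengthQP.EpsOrderLadder
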